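import Literature.AlgebraicGeometry.VanGeemenVerra2003.QuaternionSymmetry
import Literature.AlgebraicGeometry.HodgeTheory.WeilClassesCyclicPrym
import Literature.AlgebraicGeometry.VanGeemenVerra2003.QuaternionicHodgeClasses
import HarnessLib
import Literature.AlgebraicGeometry.HodgeTheory.WeilClassesCyclicPrymDegreeFour

/-!
# Quaternionic Prym eightfolds (van Geemen–Verra 2003): Weil classes algebraic for EVERY `K ⊂ ℍ_ℚ`

B. van Geemen, A. Verra, *Quaternionic Pryms and
Hodge classes*, Topology 42 (2003) 35–53 (refereed; held `paper:arxiv-math_0103111`): for a QUATERNIONIC cover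
`C̃ → C` — an unramified Galois cover with group the quaternion group `Q = {±1, ±i, ±j, ±k}` of a genus-`g` curve, so
`g(C̃) = 8g - 7` — the Prym `P := Prym(C̃ → Ĉ)`, `Ĉ = C̃/{±1}`, is a principally polarized abelian variety of dimension
`4(g-1)` of QUATERNION TYPE for Hamilton's algebra `F = ℍ_ℚ ⊂ End⁰(P)` (Prop. 2.4), hence of Weil type for every
quadratic subfield `K ⊂ F` (Lemma 4.5), and (Cor. 4.10, verbatim) "the subspace `W_F ⊂ H^{4(g-1)}(P, ℚ)` is spanned by
cycle classes. [Proof:] Let `K = ℚ(i) ⊂ ℍ_ℚ`, and consider the 4:1 unramified cover `π_i : C̃ → C̃/⟨i⟩`. By Schoen's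
result [S1], applied to the cover `π_i`, the space of Weil classes `W_K ⊂ H^{4(g-1)}(P, ℚ)` is spanned by cycle
classes. Now apply Corollary 4.9." Since `W_{K'} ⊂ W_F` for EVERY quadratic `K' ⊂ F` (Prop. 4.7: `W_F ⊗ ℂ = V_{2n+1}`,
independent of `K`), the Weil classes of `(P, K')` are algebraic for every `K' = ℚ(x)`, `x = p i + q j + r k` a non-zero
pure quaternion, `K' ≅ ℚ(√-(p²+q²+r²))` — i.e. for `ℚ(i)`, `ℚ(√-2)`, `ℚ(√-3)`, `ℚ(√-5)`, `ℚ(√-6)`, `ℚ(√-10)`, …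
(every `ℚ(√-N)`, `N` a sum of three squares). For `g = 3` these are abelian EIGHTFOLDS, a `6 = 3g-3`-dimensional family
(Thm. 3.6 / §3: the quaternionic Pryms fill a component of the 6-dimensional moduli of polarized abelian 8-folds of
quaternion type), inside the 16-dimensional period domain of `(4,4)` Weil eightfolds of each such `K'`.

THIS FILE (theorems only; the named facts it uses are HYPOTHESES BY NAME, both already in `Literature/`):
* the tree's named fact `Schoen1988_cyclicPrym_weilClasses_algebraic_degreeFour` — Schoen 1988, Cor. 3.1 + Thm. 2.0 at
  `(q, m, r) = (5, 4, 0)` (= Patel–Zhang 2025 Thm. 1.2 / 5.3 at `G = ℤ/4`, `g(C') = 5`): the primitive Prym EIGHTFOLD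
  `B = (ker(𝟙 + s²))⁰ = (ker Φ₄(s))⁰ ⊂ J(C₁₇)` of an étale cyclic cover of degree `4` of a genus-`5` curve, with
  `ψ₀ = s_B` (`ψ₀² = -1`, `K = ℚ(i)`): every class of `weilClassesOf B ψ₀ 4 1` is algebraic. The `m = 4` sibling of the
  tree's refereed facts `…_degreeThree` / `…_degreeSix` (same rendering), the instance van Geemen–Verra invoke — is USED, not declared, here.
* §1 THE QUATERNION-SYMMETRY LEMMA (`cross_eq_zero_of_quaternionSymmetric`, `map_pure_two_of_quaternionSymmetric`):
  for endomorphisms `φ, χ` of a complex abelian variety with `φ² = -a`, `χ² = -b`, `φχ = -χφ` and a class `θ ∈ H²`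
  with `φ^*θ = aθ`, `χ^*θ = bθ`, EVERY element `x = pφ + qχ + rφχ` of the order `ℤ⟨φ, χ⟩` has `x^*θ = (x x̄)θ =
  (p²a + q²b + r²ab)θ` — van Geemen–Verra's quaternion-type condition "`x^*E = x x̄ E`" (2.1) for the whole order from
  the two generators, proved on the carriers by the quadratic calculus of `f ↦ f^*θ` (`AbelianVarietyPullbackQuadratic`),
  without the Riemann form. (file `QuaternionSymmetry`).
* §2 THE QUATERNION GROUP ON THE PRYM: from a `Q`-action on the curve `C` (= the `C̃` above) given by `ι, j : C ⟶ C`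
  with `ι⁴ = 𝟙`, `j² = ι²`, `ιjι = j` and `ι²` fixed-point free, the endomorphisms `ι_P, j_P` induced on
  `P = (ker(𝟙 + (ι²)_*))⁰ ⊂ J(C)` by the norm maps satisfy `ι_P² = j_P² = -1`, `ι_P j_P = -j_P ι_P`
  (`ℤ⟨ι_P, j_P⟩ = ℍ_ℤ`), and the three cyclic subgroups `⟨ι⟩, ⟨j⟩, ⟨ιj⟩ ≅ ℤ/4` act freely with the SAME primitive Prym `P`.
* §3 THE THEOREMS: `isWeilType_quaternionicPrym` — `(P, ℚ(x))` is of Weil type `(4, p²+q²+r²)` for every non-zero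
  `x = p ι_P + q j_P + r ι_P j_P` (tree theorem `isWeilType_pure_of_anticomm`, no fact);
  **`weilClassesOf_quaternionicPrym_le_algebraicClasses`** — for every such `x`, EVERY class of the Weil plane
  `weilClassesOf P x 4 (p²+q²+r²)` is algebraic, conditional BY NAME on the two refereed facts
  `Schoen1988_cyclicPrym_weilClasses_algebraic_degreeFour` (applied to `⟨ι⟩` and `⟨ιj⟩`) and
  `VanGeemenVerra2003.VanGeemenVerra2003_quaternionHodgeClasses` (Prop. 4.7, applied to the anticommuting pairs
  `(ι_P j_P, y)` and `(y, x)`, `y = q ι_P - p j_P ⟂ x`, whose polarization hypotheses are DISCHARGED by §1 from the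
  `Q`-invariance `ι_P^*h = h = j_P^*h` of the hyperplane class);
  and the corresponding instances of the tree's statements `WeilClassesImaginaryQuadratic` (`n = 4`) and
  `SplitEightfolds` at `(A, φ, d) := (P, x, p²+q²+r²)` on this locus, from the facts and from `HodgeConjecture`.

HYPOTHESES CARRIED, NOT PROVED (each true for every quaternionic Prym, with locator): `dim P = 8` (van Geemen–Verra
Prop. 2.4: `dim P = 4(g-1)`; Patel–Zhang §5.1: each primitive character of `ℤ/4` has multiplicity `h/2 = 4` on `T₀B_prim`)
and the existence of a `Q`-INVARIANT rational hyperplane class `h = e^*l` on `P` (`Q ⊂ Aut(C̃)` acts on `J(C̃)`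
preserving `Θ`, hence on `P` preserving the restricted polarization `Ξ`, `Θ|_P ≡ 2Ξ`; any `Q`-averaged very ample
multiple is such an `h`) — both are binders of the theorems.

Known since 2003 (van Geemen–Verra Cor. 4.10 with Prop. 4.7; for `K = ℚ(i)` since Schoen 1988); a
`3g-3 = 6`-dimensional locus of principally polarized, simple, non-CM Weil-type eightfolds for each `K = ℚ(√-N)`, `N`
a sum of three squares (proper sub-locus of the 16-dimensional eightfold period domain; which discriminant component is not asserted here);
conditional on TWO refereed named facts; e.g. `K = ℚ(√-2), ℚ(√-5), ℚ(√-6), …` in dimension 8 (and, at other genera,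
in every dimension `4(g-1)`).

Provenance: Literature home (namespace `Literature.AlgebraicGeometry.VanGeemenVerra2003.QuaternionicPrym`) of the Summits-side `Theorems/WeilTypeLadderQuaternionicPrym` (b2b cell `hweil` ∕ cell `vhodge`, Weil-type ladder; all its imports are `Literature/` and Mathlib); theorems only, no named fact, no definition — the refereed named facts it uses (`Schoen1988_cyclicPrym_weilClasses_algebraic_degreeFour`, `VanGeemenVerra2003_quaternionHodgeClasses`, …) stay hypotheses BY NAME. Lane `lit-hodgefound` (Layer A2: abelian varieties of Weil ∕ quaternion type), seat p20.
-/

noncomputable section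

open _root_.CategoryTheory
open Literature.AlgebraicGeometry Literature.AlgebraicGeometry.Motives
open Literature.AlgebraicGeometry.HodgeTheory
open Literature.AlgebraicTopology.SingularHomology
open Literature.AlgebraicGeometry.VanGeemenVerra2003

namespace Literature.AlgebraicGeometry.VanGeemenVerra2003.QuaternionicPrym

/-! ### The cited fact: Schoen 1988, Cor. 3.1 at `(q, m, r) = (5, 4, 0)` — étale cyclic covers of degree `4` -/

section QuaternionicPrym

/-- **`(P, ℚ(x))` is of Weil type `(4, p² + q² + r²)` for every non-zero pure element `x = p ι_P + q j_P + r ι_P j_P`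
of `ℍ_ℤ ⊂ End(P)`** — van Geemen–Verra Lemma 4.5 ("Let `K ⊂ F` be a quadratic extension of `ℚ`. Then `A` is of Weil
type for `K`") on the quaternionic Prym, for the `Q`-action `(ι, j)` on the curve: no named fact is used (the tree
theorem `isWeilType_pure_of_anticomm` and §2). `dim P = 8` is carried (Prop. 2.4).
[cite: vanGeemenVerra2003QuaternionicPryms, Prop. 2.4 and Lemma 4.5] -/
theorem isWeilType_quaternionicPrym :
    ∀ (C : SchemeOver ℂ) (𝒥 : Jacobian C) (ι j : C ⟶ C),
      ι ≫ ι ≫ ι ≫ ι = 𝟙 C → j ≫ j = ι ≫ ι → ι ≫ j ≫ ι = j →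
    ∀ (e : 𝒥.J ⟶ 𝒥.J), e = 𝒥.pushforward 𝒥 (ι ≫ ι) →
    ∀ (ιP jP : AbelianVariety.kerComponent (𝟙 𝒥.J + e) ⟶ AbelianVariety.kerComponent (𝟙 𝒥.J + e)),
      ιP ≫ AbelianVariety.kerComponentι (𝟙 𝒥.J + e) =
        AbelianVariety.kerComponentι (𝟙 𝒥.J + e) ≫ 𝒥.pushforward 𝒥 ι →
      jP ≫ AbelianVariety.kerComponentι (𝟙 𝒥.J + e) =
        AbelianVariety.kerComponentι (𝟙 𝒥.J + e) ≫ 𝒥.pushforward 𝒥 j →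
      (AbelianVariety.kerComponent (𝟙 𝒥.J + e)).dim = 8 →
    ∀ (p q r : ℤ), (p ≠ 0 ∨ q ≠ 0 ∨ r ≠ 0) → ∀ (m : ℕ), (m : ℤ) = p ^ 2 + q ^ 2 + r ^ 2 →
      IsWeilType (AbelianVariety.kerComponent (𝟙 𝒥.J + e)) (p • ιP + q • jP + r • (ιP ≫ jP)) 4 m := by
  intro C 𝒥 ι j hι4 hjj hq e he ιP jP hιP hjP hdim p q r hpqr m hm
  have hss : 𝒥.pushforward 𝒥 ι ≫ 𝒥.pushforward 𝒥 ι = e := by rw [he, ← Jacobian.pushforward_comp]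
  have htt : 𝒥.pushforward 𝒥 j ≫ 𝒥.pushforward 𝒥 j = e := by rw [he, ← Jacobian.pushforward_comp, hjj]
  have hsts : 𝒥.pushforward 𝒥 ι ≫ 𝒥.pushforward 𝒥 j ≫ 𝒥.pushforward 𝒥 ι = 𝒥.pushforward 𝒥 j := by
    rw [← Jacobian.pushforward_comp, ← Jacobian.pushforward_comp, hq]
  have hιP2 : ιP ≫ ιP = -(1 • 𝟙 _) := by
    rw [one_smul]; exact kerComponent_restrict_comp_self_eq_neg_id hss hιP
  have hjP2 : jP ≫ jP = -(1 • 𝟙 _) := by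
    rw [one_smul]; exact kerComponent_restrict_comp_self_eq_neg_id htt hjP
  have hanti : ιP ≫ jP = -(jP ≫ ιP) := kerComponent_restrict_anticomm hss hsts hιP hjP
  exact isWeilType_pure_of_anticomm (by norm_num) one_pos one_pos (by omega) hιP2 hjP2 hanti p q r hpqr
    (by rw [hm]; ring)

/-- **MAIN THEOREM — on a quaternionic Prym eightfold the Weil classes are algebraic for EVERY quadratic
`K ⊂ ℍ_ℚ`.** Let `C` be a smooth projective complex curve of genus `17` with automorphisms `ι, j` generating a free
action of the quaternion group `Q` (`ι⁴ = 𝟙`, `j² = ι²`, `ιjι = j`, `ι²` without fixed point) — a quaternionic cover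
`C → C/Q` of a genus-`3` curve —, `P = (ker(𝟙 + (ι²)_*))⁰ ⊂ J(C)` its Prym `Prym(C → C/⟨ι²⟩)` with the induced
`ι_P, j_P` (`ℍ_ℤ ⊂ End P`), of dimension `8`, and `h = e^*l` a `Q`-invariant rational hyperplane class. Then for
every non-zero `x = p ι_P + q j_P + r ι_P j_P ∈ ℍ_ℤ` (`x² = -m`, `m = p² + q² + r²`, `K = ℚ(x) ≅ ℚ(√-m)`) EVERY class
of the Weil plane `weilClassesOf P x 4 m = W_K ⊗ ℂ` is algebraic. PROOF (van Geemen–Verra Cor. 4.10 + Prop. 4.7, made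
to run on the tree's two-generator form of Prop. 4.7): Schoen's degree-`4` fact for the free cyclic subgroups `⟨ι⟩`
and `⟨ιj⟩` (same primitive Prym `P`) makes `W_{ℚ(ι_P)}` and `W_{ℚ(ι_P j_P)}` algebraic; for `(p, q) ≠ (0, 0)` the pure
element `y = q ι_P - p j_P` anticommutes with `ι_P j_P` and with `x`, so Prop. 4.7 for the pair `(ι_P j_P, y)` gives
`W_{ℚ(y)} ⊂ W_F = Σ_z z^* W_{ℚ(ι_P j_P)}` — algebraic (Cor. 4.9, `quaternionClasses_le_algebraicClasses`) — and then
for the pair `(y, x)` gives `W_{ℚ(x)} ⊂ Σ_z z^* W_{ℚ(y)}`, algebraic; for `x = r ι_P j_P` the pair is `(ι_P, x)`. The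
polarization hypotheses of Prop. 4.7 (`z^*h = (z z̄) h` for the members of each pair) follow from `ι_P^*h = h = j_P^*h`
by the quaternion-symmetry lemma of §1. CONDITIONAL BY NAME on the refereed facts
`Schoen1988_cyclicPrym_weilClasses_algebraic_degreeFour` and `VanGeemenVerra2003_quaternionHodgeClasses`
(a `6`-dimensional locus of Weil-type eightfolds).
[cite: vanGeemenVerra2003QuaternionicPryms, Prop. 4.7, Cor. 4.9 and Cor. 4.10]
[cite: Schoen1988HodgeWeil, Cor 3.1 (p. 24) at (q, m, r) = (5, 4, 0)] -/
theorem weilClassesOf_quaternionicPrym_le_algebraicClasses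
    (hS : Literature.AlgebraicGeometry.HodgeTheory.Schoen1988_cyclicPrym_weilClasses_algebraic_degreeFour)
    (hV : VanGeemenVerra2003_quaternionHodgeClasses) :
    ∀ (C : SchemeOver ℂ) (𝒥 : Jacobian C) (ι j : C ⟶ C),
      IsSmoothProjective 1 C → 𝒥.J.dim = 17 →
      ι ≫ ι ≫ ι ≫ ι = 𝟙 C → j ≫ j = ι ≫ ι → ι ≫ j ≫ ι = j →
      (∀ P : ComplexPoints C, P ≫ (ι ≫ ι) ≠ P) →
    ∀ (e : 𝒥.J ⟶ 𝒥.J), e = 𝒥.pushforward 𝒥 (ι ≫ ι) →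
    ∀ (ιP jP : AbelianVariety.kerComponent (𝟙 𝒥.J + e) ⟶ AbelianVariety.kerComponent (𝟙 𝒥.J + e)),
      ιP ≫ AbelianVariety.kerComponentι (𝟙 𝒥.J + e) =
        AbelianVariety.kerComponentι (𝟙 𝒥.J + e) ≫ 𝒥.pushforward 𝒥 ι →
      jP ≫ AbelianVariety.kerComponentι (𝟙 𝒥.J + e) =
        AbelianVariety.kerComponentι (𝟙 𝒥.J + e) ≫ 𝒥.pushforward 𝒥 j →
      (AbelianVariety.kerComponent (𝟙 𝒥.J + e)).dim = 8 →
    ∀ (emb : ProjectiveEmbedding (AbelianVariety.kerComponent (𝟙 𝒥.J + e)).X)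
      (l : complexBetti (projectiveSpace emb.n ℂ) 2), IsRationalClass l → l ≠ 0 →
      complexBetti.map ιP.hom.hom.hom 2 (complexBetti.map emb.ι 2 l) = complexBetti.map emb.ι 2 l →
      complexBetti.map jP.hom.hom.hom 2 (complexBetti.map emb.ι 2 l) = complexBetti.map emb.ι 2 l →
    ∀ (p q r : ℤ), (p ≠ 0 ∨ q ≠ 0 ∨ r ≠ 0) → ∀ (m : ℕ), (m : ℤ) = p ^ 2 + q ^ 2 + r ^ 2 →
      weilClassesOf (AbelianVariety.kerComponent (𝟙 𝒥.J + e)) (p • ιP + q • jP + r • (ιP ≫ jP)) 4 m ≤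
        algebraicClasses (AbelianVariety.kerComponent (𝟙 𝒥.J + e)).X 4 := by
  intro C 𝒥 ι j hC h17 hι4 hjj hq hfree e he ιP jP hιP hjP hdim emb l hl hl0 hθι hθj p q r hpqr m hm
  -- §2 on the Jacobian
  have hss : 𝒥.pushforward 𝒥 ι ≫ 𝒥.pushforward 𝒥 ι = e := by rw [he, ← Jacobian.pushforward_comp]
  have htt : 𝒥.pushforward 𝒥 j ≫ 𝒥.pushforward 𝒥 j = e := by rw [he, ← Jacobian.pushforward_comp, hjj]
  have hsts : 𝒥.pushforward 𝒥 ι ≫ 𝒥.pushforward 𝒥 j ≫ 𝒥.pushforward 𝒥 ι = 𝒥.pushforward 𝒥 j := by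
    rw [← Jacobian.pushforward_comp, ← Jacobian.pushforward_comp, hq]
  have hkk : (ι ≫ j) ≫ (ι ≫ j) = ι ≫ ι := quaternion_k_sq hjj hq
  have hek : e = 𝒥.pushforward 𝒥 (ι ≫ j) ≫ 𝒥.pushforward 𝒥 (ι ≫ j) := by
    rw [← Jacobian.pushforward_comp, hkk, he]
  -- §2 on the Prym: `ℍ_ℤ = ℤ⟨ι_P, j_P⟩`
  have hιP2 : ιP ≫ ιP = -(1 • 𝟙 _) := by
    rw [one_smul]; exact kerComponent_restrict_comp_self_eq_neg_id hss hιP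
  have hjP2 : jP ≫ jP = -(1 • 𝟙 _) := by
    rw [one_smul]; exact kerComponent_restrict_comp_self_eq_neg_id htt hjP
  have hanti : ιP ≫ jP = -(jP ≫ ιP) := kerComponent_restrict_anticomm hss hsts hιP hjP
  have hkP : (ιP ≫ jP) ≫ AbelianVariety.kerComponentι (𝟙 𝒥.J + e) =
      AbelianVariety.kerComponentι (𝟙 𝒥.J + e) ≫ 𝒥.pushforward 𝒥 (ι ≫ j) := by
    rw [Jacobian.pushforward_comp, Category.assoc, hjP, ← Category.assoc, hιP, Category.assoc]
  have hk2 : (ιP ≫ jP) ≫ (ιP ≫ jP) = -(1 • 𝟙 _) := by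
    have := comp_comp_self_of_anticomm hιP2 hjP2 hanti; rwa [mul_one] at this
  have hιk : ιP ≫ (ιP ≫ jP) = -((ιP ≫ jP) ≫ ιP) := anticomm_comp_of_anticomm hanti
  have hjk : jP ≫ (ιP ≫ jP) = -((ιP ≫ jP) ≫ jP) := by
    rw [← Category.assoc, comp_eq_neg_comp_of_anticomm hanti, Preadditive.neg_comp, Category.assoc]
  -- dimension, positivity
  have hdim' : (AbelianVariety.kerComponent (𝟙 𝒥.J + e)).dim = 2 * 4 := by rw [hdim]
  have hm0 : 0 < m := by
    have : (0 : ℤ) < m := by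
      rw [hm]
      rcases hpqr with h0 | h0 | h0 <;> positivity
    exact_mod_cast this
  -- the class `h = emb^* l` and its symmetries (§1)
  have hθι' : complexBetti.map ιP.hom.hom.hom 2 (complexBetti.map emb.ι 2 l) =
      ((1 : ℕ) : ℂ) • complexBetti.map emb.ι 2 l := by rw [Nat.cast_one, one_smul]; exact hθι
  have hθj' : complexBetti.map jP.hom.hom.hom 2 (complexBetti.map emb.ι 2 l) =
      ((1 : ℕ) : ℂ) • complexBetti.map emb.ι 2 l := by rw [Nat.cast_one, one_smul]; exact hθj
  have hθk' : complexBetti.map (ιP ≫ jP).hom.hom.hom 2 (complexBetti.map emb.ι 2 l) =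
      ((1 : ℕ) : ℂ) • complexBetti.map emb.ι 2 l := by
    rw [← complexBetti_map_map_hom, hθj, hθι, Nat.cast_one, one_smul]
  have hθx : complexBetti.map (p • ιP + q • jP + r • (ιP ≫ jP)).hom.hom.hom 2 (complexBetti.map emb.ι 2 l) =
      (m : ℂ) • complexBetti.map emb.ι 2 l := by
    rw [map_pure_two_of_quaternionSymmetric one_pos one_pos hιP2 hjP2 hanti hθι' hθj' p q r]
    congr 1
    have : ((p ^ 2 * (1 : ℕ) + q ^ 2 * (1 : ℕ) + r ^ 2 * ((1 : ℕ) * (1 : ℕ)) : ℤ) : ℂ) = ((m : ℤ) : ℂ) := by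
      rw [hm]; push_cast; ring
    rw [this, Int.cast_natCast]
  -- `x² = -m`
  have hx2 : (p • ιP + q • jP + r • (ιP ≫ jP)) ≫ (p • ιP + q • jP + r • (ιP ≫ jP)) = -(m • 𝟙 _) :=
    pure_comp_pure_eq hιP2 hjP2 hanti p q r (by rw [hm]; ring)
  -- Schoen for `⟨ι⟩` and `⟨ιj⟩`
  have hWι : weilClassesOf (AbelianVariety.kerComponent (𝟙 𝒥.J + e)) ιP 4 1 ≤
      algebraicClasses (AbelianVariety.kerComponent (𝟙 𝒥.J + e)).X 4 :=
    fun c hc ↦ hS C 𝒥 ι hC h17 hι4 hfree _ e rfl hss.symm ιP hιP c hc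
  have hWk : weilClassesOf (AbelianVariety.kerComponent (𝟙 𝒥.J + e)) (ιP ≫ jP) 4 1 ≤
      algebraicClasses (AbelianVariety.kerComponent (𝟙 𝒥.J + e)).X 4 :=
    fun c hc ↦ hS C 𝒥 (ι ≫ j) hC h17 (quaternion_k_pow_four hι4 hjj hq)
      (fun Pt ↦ by rw [hkk]; exact hfree Pt) _ e rfl hek (ιP ≫ jP) hkP c hc
  by_cases hpq : p = 0 ∧ q = 0
  · -- `x = r ι_P j_P`: the pair `(ι_P, x)`
    obtain ⟨rfl, rfl⟩ := hpq
    have hιx : ιP ≫ ((0 : ℤ) • ιP + (0 : ℤ) • jP + r • (ιP ≫ jP)) =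
        -(((0 : ℤ) • ιP + (0 : ℤ) • jP + r • (ιP ≫ jP)) ≫ ιP) := by
      simp only [zero_smul, zero_add, Preadditive.comp_zsmul, Preadditive.zsmul_comp, hιk, smul_neg]
    obtain ⟨-, -, hEq, -⟩ := hV _ ιP _ 4 1 m emb l (by norm_num) one_pos hm0 hdim' hιP2 hx2 hιx hl hl0
      hθι' hθx
    calc weilClassesOf _ ((0 : ℤ) • ιP + (0 : ℤ) • jP + r • (ιP ≫ jP)) 4 m
        ≤ quaternionClasses _ ιP ((0 : ℤ) • ιP + (0 : ℤ) • jP + r • (ιP ≫ jP))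
            ((0 : ℤ) • ιP + (0 : ℤ) • jP + r • (ιP ≫ jP)) 4 m :=
          weilClassesOf_le_quaternionClasses _ 4 m
      _ = quaternionClasses _ ιP ((0 : ℤ) • ιP + (0 : ℤ) • jP + r • (ιP ≫ jP)) ιP 4 1 := hEq.symm
      _ ≤ algebraicClasses _ 4 := quaternionClasses_le_algebraicClasses ιP 4 1 hWι
  · -- `(p, q) ≠ (0, 0)`: the partner `y = q ι_P - p j_P`, pairs `(ι_P j_P, y)` and `(y, x)`
    have hpq' : p ≠ 0 ∨ q ≠ 0 := not_and_or.mp hpq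
    -- `y² = -m'`, `m' = q² + p²`
    have hnonneg : (0 : ℤ) ≤ q ^ 2 + p ^ 2 := by positivity
    obtain ⟨m', hm'ℤ⟩ := Int.eq_ofNat_of_zero_le hnonneg
    have hm' : (m' : ℤ) = (q * (1 : ℕ)) ^ 2 * (1 : ℕ) + (-(p * (1 : ℕ))) ^ 2 * (1 : ℕ) +
        0 ^ 2 * ((1 : ℕ) * (1 : ℕ)) := by rw [← hm'ℤ]; push_cast; ring
    have hm'0 : 0 < m' := by
      have : (0 : ℤ) < m' := by
        rw [← hm'ℤ]
        rcases hpq' with h0 | h0 <;> positivity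
      exact_mod_cast this
    have hy2 := pure_comp_pure_eq hιP2 hjP2 hanti (q * (1 : ℕ)) (-(p * (1 : ℕ))) 0 hm'
    -- anticommutations
    have hxy := pure_anticomm hιP2 hjP2 hanti p q r
    have hyx := comp_eq_neg_comp_of_anticomm hxy
    have hky : (ιP ≫ jP) ≫ ((q * (1 : ℕ) : ℤ) • ιP + (-(p * (1 : ℕ)) : ℤ) • jP + (0 : ℤ) • (ιP ≫ jP)) =
        -(((q * (1 : ℕ) : ℤ) • ιP + (-(p * (1 : ℕ)) : ℤ) • jP + (0 : ℤ) • (ιP ≫ jP)) ≫ (ιP ≫ jP)) := by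
      simp only [zero_smul, add_zero, Preadditive.comp_add, Preadditive.add_comp, Preadditive.comp_zsmul,
        Preadditive.zsmul_comp, comp_eq_neg_comp_of_anticomm hιk, comp_eq_neg_comp_of_anticomm hjk,
        smul_neg, neg_add]
    -- `y^* h = m' h`
    have hθy : complexBetti.map ((q * (1 : ℕ) : ℤ) • ιP + (-(p * (1 : ℕ)) : ℤ) • jP +
          (0 : ℤ) • (ιP ≫ jP)).hom.hom.hom 2 (complexBetti.map emb.ι 2 l) =
        (m' : ℂ) • complexBetti.map emb.ι 2 l := by
      rw [map_pure_two_of_quaternionSymmetric one_pos one_pos hιP2 hjP2 hanti hθι' hθj']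
      congr 1
      rw [← Int.cast_natCast (R := ℂ) m', hm']
    -- Prop. 4.7 for the pair `(ι_P j_P, y)`: `W_{ℚ(y)}` is algebraic
    obtain ⟨-, -, hEq1, -⟩ := hV _ (ιP ≫ jP) _ 4 1 m' emb l (by norm_num) one_pos hm'0 hdim' hk2 hy2 hky
      hl hl0 hθk' hθy
    have hWy : weilClassesOf _ ((q * (1 : ℕ) : ℤ) • ιP + (-(p * (1 : ℕ)) : ℤ) • jP + (0 : ℤ) • (ιP ≫ jP))
        4 m' ≤ algebraicClasses (AbelianVariety.kerComponent (𝟙 𝒥.J + e)).X 4 :=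
      calc weilClassesOf _ _ 4 m'
          ≤ quaternionClasses _ (ιP ≫ jP) _ _ 4 m' := weilClassesOf_le_quaternionClasses _ 4 m'
        _ = quaternionClasses _ (ιP ≫ jP) _ (ιP ≫ jP) 4 1 := hEq1.symm
        _ ≤ algebraicClasses _ 4 := quaternionClasses_le_algebraicClasses (ιP ≫ jP) 4 1 hWk
    -- Prop. 4.7 for the pair `(y, x)`: `W_{ℚ(x)}` is algebraic
    obtain ⟨-, -, hEq2, -⟩ := hV _ _ _ 4 m' m emb l (by norm_num) hm'0 hm0 hdim' hy2 hx2 hyx hl hl0 hθy hθx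
    calc weilClassesOf _ (p • ιP + q • jP + r • (ιP ≫ jP)) 4 m
        ≤ quaternionClasses _ _ (p • ιP + q • jP + r • (ιP ≫ jP)) (p • ιP + q • jP + r • (ιP ≫ jP)) 4 m :=
          weilClassesOf_le_quaternionClasses _ 4 m
      _ = quaternionClasses _ _ (p • ιP + q • jP + r • (ιP ≫ jP)) _ 4 m' := hEq2.symm
      _ ≤ algebraicClasses _ 4 := quaternionClasses_le_algebraicClasses _ 4 m' hWy

/-- **The statement `WeilClassesImaginaryQuadratic` at `n = 4`, `d = p²+q²+r²`, `(A, φ) := (P, x)` on the quaternionic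
Prym locus, from the two refereed facts**: every RATIONAL `(4,4)`-class of the Weil plane of `(P, ℚ(x))` is
algebraic (hypotheses `dim = 2·4`, smooth projective, `x² = -d` carried; a `6`-dimensional locus in dimension `8`,
every `K ⊂ ℍ_ℚ`).
[cite: vanGeemenVerra2003QuaternionicPryms, Cor. 4.10 with Prop. 4.7] -/
theorem weilClassesImaginaryQuadratic_quaternionicPrym_of_schoen_vanGeemenVerra
    (hS : Literature.AlgebraicGeometry.HodgeTheory.Schoen1988_cyclicPrym_weilClasses_algebraic_degreeFour)
    (hV : VanGeemenVerra2003_quaternionHodgeClasses) :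
    ∀ (C : SchemeOver ℂ) (𝒥 : Jacobian C) (ι j : C ⟶ C),
      IsSmoothProjective 1 C → 𝒥.J.dim = 17 →
      ι ≫ ι ≫ ι ≫ ι = 𝟙 C → j ≫ j = ι ≫ ι → ι ≫ j ≫ ι = j →
      (∀ P : ComplexPoints C, P ≫ (ι ≫ ι) ≠ P) →
    ∀ (e : 𝒥.J ⟶ 𝒥.J), e = 𝒥.pushforward 𝒥 (ι ≫ ι) →
    ∀ (ιP jP : AbelianVariety.kerComponent (𝟙 𝒥.J + e) ⟶ AbelianVariety.kerComponent (𝟙 𝒥.J + e)),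
      ιP ≫ AbelianVariety.kerComponentι (𝟙 𝒥.J + e) =
        AbelianVariety.kerComponentι (𝟙 𝒥.J + e) ≫ 𝒥.pushforward 𝒥 ι →
      jP ≫ AbelianVariety.kerComponentι (𝟙 𝒥.J + e) =
        AbelianVariety.kerComponentι (𝟙 𝒥.J + e) ≫ 𝒥.pushforward 𝒥 j →
    ∀ (emb : ProjectiveEmbedding (AbelianVariety.kerComponent (𝟙 𝒥.J + e)).X)
      (l : complexBetti (projectiveSpace emb.n ℂ) 2), IsRationalClass l → l ≠ 0 →
      complexBetti.map ιP.hom.hom.hom 2 (complexBetti.map emb.ι 2 l) = complexBetti.map emb.ι 2 l →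
      complexBetti.map jP.hom.hom.hom 2 (complexBetti.map emb.ι 2 l) = complexBetti.map emb.ι 2 l →
    ∀ (p q r : ℤ), (p ≠ 0 ∨ q ≠ 0 ∨ r ≠ 0) → ∀ (m : ℕ), (m : ℤ) = p ^ 2 + q ^ 2 + r ^ 2 →
      (AbelianVariety.kerComponent (𝟙 𝒥.J + e)).dim = 2 * 4 →
      IsSmoothProjective (2 * 4) (AbelianVariety.kerComponent (𝟙 𝒥.J + e)).X →
      (p • ιP + q • jP + r • (ιP ≫ jP)) ≫ (p • ιP + q • jP + r • (ιP ≫ jP)) = -(m • 𝟙 _) →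
      ∀ c : complexBetti (AbelianVariety.kerComponent (𝟙 𝒥.J + e)).X (2 * 4), IsRationalClass c →
        IsOfHodgeType (2 * 4) (AbelianVariety.kerComponent (𝟙 𝒥.J + e)).X (2 * 4) 4 4 c →
        c ∈ weilClassesOf (AbelianVariety.kerComponent (𝟙 𝒥.J + e)) (p • ιP + q • jP + r • (ιP ≫ jP)) 4 m →
        c ∈ algebraicClasses (AbelianVariety.kerComponent (𝟙 𝒥.J + e)).X 4 := by
  intro C 𝒥 ι j hC h17 hι4 hjj hq hfree e he ιP jP hιP hjP emb l hl hl0 hθι hθj p q r hpqr m hm hdim _ _ c _ _ hW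
  exact weilClassesOf_quaternionicPrym_le_algebraicClasses hS hV C 𝒥 ι j hC h17 hι4 hjj hq hfree e he ιP jP hιP
    hjP (by rw [hdim]) emb l hl hl0 hθι hθj p q r hpqr m hm hW

end QuaternionicPrym

end Literature.AlgebraicGeometry.VanGeemenVerra2003.QuaternionicPrym

end
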